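import Summits.Ventures.YMGap.RobustBall.StateDerivativeOnBallS
import Summits.Ventures.YMGap.RobustBall.SourceGeometry
import Summits.Ventures.YMGap.Thresholds.ConnectedThreePointTools
import Literature.Probability.LatticeModels.RescaledUrsellUniformOnCompact
import HarnessLib

/-!
# Venture YMGap, track ROBUST-BALL (Y2) — TIER 2 TOOLS: THE THIRD AND FOURTH CUMULANTS ALONG A FAMILY OF STATES (UNIFORM CONVERGENCE, CONTINUITY, FEYNMAN–HELLMANN)

HONEST FRAMING. WHAT THIS IS: a venture file (cell `pub-ymgap`, track Y2 ROBUST-BALL, seat rb-p1, theorems only), generic probability bookkeeping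
for the derivative form `u₄` of the fourth cumulant (ds-1, `ConnectedFourPointAlgebra`) and the third cumulant `u₃`, along families of probability
measures indexed by a real parameter:
* `abs_threePoint_le_six` — `|u₃(f; g; h)| ≤ 6 M_f M_g M_h` for bounded measurable observables;
* `tendstoUniformlyOn_threePoint_of_moments`, `tendstoUniformlyOn_fourPoint_of_moments` — if the expectations of a multiplicatively closed class
  of bounded measurable observables converge uniformly (`ν_n(s) → ν(s)` on `I`), so do `u₃` and `u₄` of members of the class;
* `continuous_threePoint_of_moments`, `continuous_fourPoint_of_moments` — if every bounded measurable expectation is continuous along `κ(s)`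
  (tilt formula), so are `u₃`, `u₄`;
* `hasDerivAt_threePoint_of_oracle` — FEYNMAN–HELLMANN FOR `u₃`: if means and covariances differentiate along `κ(s)` with derivatives
  `−Σ_{A∈T} cov(·, V_A)` and `−Σ_{A∈T} u₃(·; ·; V_A)`, then `d/ds u₃(F; G; K) = −Σ_{A∈T} u₄(F; G; K; V_A)` — the derivative form of `u₄` is
  exactly the product rule.
These are the `u₄`-level twins of the tools inside `StateSecondDerivativeS`; the successor file uses them for `C³` of the state along the lines
of the weighted ball.
WHAT THIS IS NOT: anything lattice-specific; nothing about the continuum limit or a Clay-sense mass gap.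
-/

noncomputable section

open MeasureTheory Function Finset ProbabilityTheory Real Filter Topology
open Literature.Probability.LatticeModels
open Summit.Ventures.YMGap.CouplingResponse (abs_threePoint_le)

namespace Summit.Ventures.YMGap.RobustBall

/-- Local shorthand: the connected three-point function `u₃(X; Y; Z)` under `μ`. -/
local notation3 (prettyPrint := false) "U₃[" X ";" Y ";" Z ";" μ "]" =>
  cov[fun ω => X ω * Y ω, Z; μ] - (∫ ω, X ω ∂μ) * cov[Y, Z; μ] - (∫ ω, Y ω ∂μ) * cov[X, Z; μ]

/-- Local shorthand: the connected four-point function in derivative form `u₄(X; Y; Z; W)` under `μ`. -/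
local notation3 (prettyPrint := false) "U₄[" X ";" Y ";" Z ";" W' ";" μ "]" =>
  (cov[fun ω => (X ω * Y ω) * Z ω, W'; μ] - (∫ ω, X ω * Y ω ∂μ) * cov[Z, W'; μ] - (∫ ω, Z ω ∂μ) * cov[fun ω => X ω * Y ω, W'; μ])
  - cov[X, W'; μ] * cov[Y, Z; μ] - (∫ ω, X ω ∂μ) * U₃[Y ; Z ; W' ; μ]
  - cov[Y, W'; μ] * cov[X, Z; μ] - (∫ ω, Y ω ∂μ) * U₃[X ; Z ; W' ; μ]

variable {Ω : Type*} [MeasurableSpace Ω]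

/-! ### A crude bound on the third cumulant -/

/-- `|u₃(f; g; h)| ≤ 6 M_f M_g M_h` for bounded measurable observables under a probability measure. -/
theorem abs_threePoint_le_six {μ : Measure Ω} [IsProbabilityMeasure μ] {f g h : Ω → ℝ} {Mf Mg Mh : ℝ}
    (hfm : Measurable f) (hgm : Measurable g) (hhm : Measurable h) (hMf0 : 0 ≤ Mf) (hMg0 : 0 ≤ Mg)
    (hMf : ∀ ω, |f ω| ≤ Mf) (hMg : ∀ ω, |g ω| ≤ Mg) (hMh : ∀ ω, |h ω| ≤ Mh) :
    |U₃[f ; g ; h ; μ]| ≤ 6 * Mf * Mg * Mh := by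
  have hfg : ∀ ω, |f ω * g ω| ≤ Mf * Mg := fun ω => by rw [abs_mul]; exact mul_le_mul (hMf ω) (hMg ω) (abs_nonneg _) hMf0
  have h1 := abs_covariance_le_two_mul (μ := μ) (hfm.mul hgm) hfg hhm hMh
  have h2 := abs_covariance_le_two_mul (μ := μ) hgm hMg hhm hMh
  have h3 := abs_covariance_le_two_mul (μ := μ) hfm hMf hhm hMh
  calc |U₃[f ; g ; h ; μ]| ≤ |cov[fun ω => f ω * g ω, h; μ]| + Mf * |cov[g, h; μ]| + Mg * |cov[f, h; μ]| := abs_threePoint_le hMf hMg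
    _ ≤ 2 * (Mf * Mg) * Mh + Mf * (2 * Mg * Mh) + Mg * (2 * Mf * Mh) :=
        add_le_add (add_le_add h1 (mul_le_mul_of_nonneg_left h2 hMf0)) (mul_le_mul_of_nonneg_left h3 hMg0)
    _ = 6 * Mf * Mg * Mh := by ring

/-! ### Uniform convergence of `u₃`, `u₄` from uniform convergence of the moments of a multiplicative class -/

section Uniform

variable {νn : ℕ → ℝ → Measure Ω} {ν : ℝ → Measure Ω} {I : Set ℝ} {C : (Ω → ℝ) → ℝ → Prop}

/-- **`u₃` converges uniformly when the moments of a multiplicatively closed class do.**  `C f M` is any class of bounded (`|f| ≤ M`, `M ≥ 0`)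
measurable observables closed under products whose expectations converge uniformly on `I` along `ν_n(s) → ν(s)` (probability measures). -/
theorem tendstoUniformlyOn_threePoint_of_moments (hνn : ∀ n, ∀ s ∈ I, IsProbabilityMeasure (νn n s)) (hν : ∀ s ∈ I, IsProbabilityMeasure (ν s))
    (hCm : ∀ {f M}, C f M → Measurable f) (hCb : ∀ {f M}, C f M → ∀ ω, |f ω| ≤ M) (hC0 : ∀ {f M}, C f M → 0 ≤ M)
    (hCmul : ∀ {f g Mf Mg}, C f Mf → C g Mg → C (fun ω => f ω * g ω) (Mf * Mg))
    (hunif : ∀ {f M}, C f M → TendstoUniformlyOn (fun n s => ∫ ω, f ω ∂(νn n s)) (fun s => ∫ ω, f ω ∂(ν s)) atTop I)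
    {f g h : Ω → ℝ} {Mf Mg Mh : ℝ} (hf : C f Mf) (hg : C g Mg) (hh : C h Mh) :
    TendstoUniformlyOn (fun n s => U₃[f ; g ; h ; νn n s]) (fun s => U₃[f ; g ; h ; ν s]) atTop I := by
  have hcov : ∀ {f g Mf Mg}, C f Mf → C g Mg →
      TendstoUniformlyOn (fun n s => cov[f, g; νn n s]) (fun s => cov[f, g; ν s]) atTop I := fun hf hg =>
    tendstoUniformlyOn_cov hνn hν (hCm hf) (hCm hg) (hC0 hf) (hC0 hg) (hCb hf) (hCb hg) (hunif hf) (hunif hg) (hunif (hCmul hf hg))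
  have h1 := hcov (hCmul hf hg) hh
  have h2 := tendstoUniformlyOn_mul_of_abs_le (M₁ := Mf) (M₂ := 2 * Mg * Mh) (hC0 hf)
    (by have := hC0 hg; have := hC0 hh; positivity) (hunif hf) (hcov hg hh)
    (fun s hs => by haveI := hν s hs; exact abs_integral_le_of_abs_le (hCb hf))
    (fun s hs => by haveI := hν s hs; exact abs_covariance_le_two_mul (hCm hg) (hCb hg) (hCm hh) (hCb hh))
  have h3 := tendstoUniformlyOn_mul_of_abs_le (M₁ := Mg) (M₂ := 2 * Mf * Mh) (hC0 hg)
    (by have := hC0 hf; have := hC0 hh; positivity) (hunif hg) (hcov hf hh)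
    (fun s hs => by haveI := hν s hs; exact abs_integral_le_of_abs_le (hCb hg))
    (fun s hs => by haveI := hν s hs; exact abs_covariance_le_two_mul (hCm hf) (hCb hf) (hCm hh) (hCb hh))
  exact (h1.sub h2).sub h3

/-- **`u₄` (derivative form) converges uniformly when the moments of a multiplicatively closed class do.** -/
theorem tendstoUniformlyOn_fourPoint_of_moments (hνn : ∀ n, ∀ s ∈ I, IsProbabilityMeasure (νn n s)) (hν : ∀ s ∈ I, IsProbabilityMeasure (ν s))
    (hCm : ∀ {f M}, C f M → Measurable f) (hCb : ∀ {f M}, C f M → ∀ ω, |f ω| ≤ M) (hC0 : ∀ {f M}, C f M → 0 ≤ M)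
    (hCmul : ∀ {f g Mf Mg}, C f Mf → C g Mg → C (fun ω => f ω * g ω) (Mf * Mg))
    (hunif : ∀ {f M}, C f M → TendstoUniformlyOn (fun n s => ∫ ω, f ω ∂(νn n s)) (fun s => ∫ ω, f ω ∂(ν s)) atTop I)
    {f g h k : Ω → ℝ} {Mf Mg Mh Mk : ℝ} (hf : C f Mf) (hg : C g Mg) (hh : C h Mh) (hk : C k Mk) :
    TendstoUniformlyOn (fun n s => U₄[f ; g ; h ; k ; νn n s]) (fun s => U₄[f ; g ; h ; k ; ν s]) atTop I := by
  have hcov : ∀ {f g Mf Mg}, C f Mf → C g Mg →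
      TendstoUniformlyOn (fun n s => cov[f, g; νn n s]) (fun s => cov[f, g; ν s]) atTop I := fun hf hg =>
    tendstoUniformlyOn_cov hνn hν (hCm hf) (hCm hg) (hC0 hf) (hC0 hg) (hCb hf) (hCb hg) (hunif hf) (hunif hg) (hunif (hCmul hf hg))
  have hcovb : ∀ {f g Mf Mg}, C f Mf → C g Mg → ∀ s ∈ I, |cov[f, g; ν s]| ≤ 2 * Mf * Mg := fun hf hg s hs => by
    haveI := hν s hs; exact abs_covariance_le_two_mul (hCm hf) (hCb hf) (hCm hg) (hCb hg)
  have hmb : ∀ {f M}, C f M → ∀ s ∈ I, |∫ ω, f ω ∂(ν s)| ≤ M := fun hf s hs => by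
    haveI := hν s hs; exact abs_integral_le_of_abs_le (hCb hf)
  have hU3 : ∀ {f g h Mf Mg Mh}, C f Mf → C g Mg → C h Mh →
      TendstoUniformlyOn (fun n s => U₃[f ; g ; h ; νn n s]) (fun s => U₃[f ; g ; h ; ν s]) atTop I := fun hf hg hh =>
    tendstoUniformlyOn_threePoint_of_moments hνn hν hCm hCb hC0 hCmul hunif hf hg hh
  have hU3b : ∀ {f g h Mf Mg Mh}, C f Mf → C g Mg → C h Mh → ∀ s ∈ I, |U₃[f ; g ; h ; ν s]| ≤ 6 * Mf * Mg * Mh :=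
    fun hf hg hh s hs => by
      haveI := hν s hs
      exact abs_threePoint_le_six (hCm hf) (hCm hg) (hCm hh) (hC0 hf) (hC0 hg) (hCb hf) (hCb hg) (hCb hh)
  have h0f := hC0 hf; have h0g := hC0 hg; have h0h := hC0 hh; have h0k := hC0 hk
  have hA := hU3 (hCmul hf hg) hh hk
  have hB := tendstoUniformlyOn_mul_of_abs_le (M₁ := 2 * Mf * Mk) (M₂ := 2 * Mg * Mh) (by positivity) (by positivity) (hcov hf hk) (hcov hg hh)
    (hcovb hf hk) (hcovb hg hh)
  have hC := tendstoUniformlyOn_mul_of_abs_le (M₁ := Mf) (M₂ := 6 * Mg * Mh * Mk) h0f (by positivity) (hunif hf) (hU3 hg hh hk)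
    (hmb hf) (hU3b hg hh hk)
  have hD := tendstoUniformlyOn_mul_of_abs_le (M₁ := 2 * Mg * Mk) (M₂ := 2 * Mf * Mh) (by positivity) (by positivity) (hcov hg hk) (hcov hf hh)
    (hcovb hg hk) (hcovb hf hh)
  have hE := tendstoUniformlyOn_mul_of_abs_le (M₁ := Mg) (M₂ := 6 * Mf * Mh * Mk) h0g (by positivity) (hunif hg) (hU3 hf hh hk)
    (hmb hg) (hU3b hf hh hk)
  exact (((hA.sub hB).sub hC).sub hD).sub hE

end Uniform

/-! ### Continuity of `u₃`, `u₄` along a family with continuous bounded expectations -/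

section Continuity

variable {κ : ℝ → Measure Ω}

/-- **`u₃` is continuous along `κ(s)`** if every bounded measurable expectation is (probability measures). -/
theorem continuous_threePoint_of_moments (hκ : ∀ s, IsProbabilityMeasure (κ s))
    (hint : ∀ {f : Ω → ℝ} {M : ℝ}, Measurable f → (∀ ω, |f ω| ≤ M) → Continuous fun s => ∫ ω, f ω ∂(κ s))
    {f g h : Ω → ℝ} {Mf Mg Mh : ℝ} (hfm : Measurable f) (hgm : Measurable g) (hhm : Measurable h) (hMf0 : 0 ≤ Mf)
    (hMf : ∀ ω, |f ω| ≤ Mf) (hMg : ∀ ω, |g ω| ≤ Mg) (hMh : ∀ ω, |h ω| ≤ Mh) :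
    Continuous fun s => U₃[f ; g ; h ; κ s] := by
  have hcovc : ∀ {f g : Ω → ℝ} {Mf Mg : ℝ}, Measurable f → Measurable g → (∀ ω, |f ω| ≤ Mf) → (∀ ω, |g ω| ≤ Mg) →
      Continuous fun s => cov[f, g; κ s] := by
    intro f g Mf Mg hfm hgm hMf hMg
    have heq : (fun s => cov[f, g; κ s]) = fun s => (∫ ω, f ω * g ω ∂(κ s)) - (∫ ω, f ω ∂(κ s)) * ∫ ω, g ω ∂(κ s) :=
      funext fun s => by
        haveI := hκ s
        have hf2 : MemLp f 2 (κ s) := MemLp.of_bound hfm.aestronglyMeasurable Mf (Eventually.of_forall fun ω => by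
          rw [Real.norm_eq_abs]; exact hMf ω)
        have hg2 : MemLp g 2 (κ s) := MemLp.of_bound hgm.aestronglyMeasurable Mg (Eventually.of_forall fun ω => by
          rw [Real.norm_eq_abs]; exact hMg ω)
        rw [covariance_eq_sub hf2 hg2]; rfl
    rw [heq]
    have hMf0 : 0 ≤ |Mf| := abs_nonneg _
    exact (hint (hfm.mul hgm) (M := |Mf| * Mg) fun ω => (abs_mul _ _).trans_le
      (mul_le_mul ((hMf ω).trans (le_abs_self _)) (hMg ω) (abs_nonneg _) hMf0)).sub ((hint hfm hMf).mul (hint hgm hMg))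
  have hfg : ∀ ω, |f ω * g ω| ≤ Mf * Mg := fun ω => by rw [abs_mul]; exact mul_le_mul (hMf ω) (hMg ω) (abs_nonneg _) hMf0
  exact ((hcovc (hfm.mul hgm) hhm hfg hMh).sub ((hint hfm hMf).mul (hcovc hgm hhm hMg hMh))).sub
    ((hint hgm hMg).mul (hcovc hfm hhm hMf hMh))

/-- **`u₄` (derivative form) is continuous along `κ(s)`** if every bounded measurable expectation is (probability measures). -/
theorem continuous_fourPoint_of_moments (hκ : ∀ s, IsProbabilityMeasure (κ s))
    (hint : ∀ {f : Ω → ℝ} {M : ℝ}, Measurable f → (∀ ω, |f ω| ≤ M) → Continuous fun s => ∫ ω, f ω ∂(κ s))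
    {f g h k : Ω → ℝ} {Mf Mg Mh Mk : ℝ} (hfm : Measurable f) (hgm : Measurable g) (hhm : Measurable h) (hkm : Measurable k)
    (hMf0 : 0 ≤ Mf) (hMg0 : 0 ≤ Mg) (hMf : ∀ ω, |f ω| ≤ Mf) (hMg : ∀ ω, |g ω| ≤ Mg) (hMh : ∀ ω, |h ω| ≤ Mh) (hMk : ∀ ω, |k ω| ≤ Mk) :
    Continuous fun s => U₄[f ; g ; h ; k ; κ s] := by
  have hcovc : ∀ {f g : Ω → ℝ} {Mf Mg : ℝ}, Measurable f → Measurable g → (∀ ω, |f ω| ≤ Mf) → (∀ ω, |g ω| ≤ Mg) →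
      Continuous fun s => cov[f, g; κ s] := by
    intro f g Mf Mg hfm hgm hMf hMg
    have heq : (fun s => cov[f, g; κ s]) = fun s => (∫ ω, f ω * g ω ∂(κ s)) - (∫ ω, f ω ∂(κ s)) * ∫ ω, g ω ∂(κ s) :=
      funext fun s => by
        haveI := hκ s
        have hf2 : MemLp f 2 (κ s) := MemLp.of_bound hfm.aestronglyMeasurable Mf (Eventually.of_forall fun ω => by
          rw [Real.norm_eq_abs]; exact hMf ω)
        have hg2 : MemLp g 2 (κ s) := MemLp.of_bound hgm.aestronglyMeasurable Mg (Eventually.of_forall fun ω => by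
          rw [Real.norm_eq_abs]; exact hMg ω)
        rw [covariance_eq_sub hf2 hg2]; rfl
    rw [heq]
    have hMf0 : 0 ≤ |Mf| := abs_nonneg _
    exact (hint (hfm.mul hgm) (M := |Mf| * Mg) fun ω => (abs_mul _ _).trans_le
      (mul_le_mul ((hMf ω).trans (le_abs_self _)) (hMg ω) (abs_nonneg _) hMf0)).sub ((hint hfm hMf).mul (hint hgm hMg))
  have hu3 : ∀ {f g h : Ω → ℝ} {Mf Mg Mh : ℝ}, Measurable f → Measurable g → Measurable h → 0 ≤ Mf → (∀ ω, |f ω| ≤ Mf) →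
      (∀ ω, |g ω| ≤ Mg) → (∀ ω, |h ω| ≤ Mh) → Continuous fun s => U₃[f ; g ; h ; κ s] :=
    fun hfm hgm hhm hMf0 hMf hMg hMh => continuous_threePoint_of_moments hκ hint hfm hgm hhm hMf0 hMf hMg hMh
  have hfg : ∀ ω, |f ω * g ω| ≤ Mf * Mg := fun ω => by rw [abs_mul]; exact mul_le_mul (hMf ω) (hMg ω) (abs_nonneg _) hMf0
  have hfgm : Measurable fun ω => f ω * g ω := hfm.mul hgm
  have hA : Continuous fun s => cov[fun ω => (f ω * g ω) * h ω, k; κ s] - (∫ ω, f ω * g ω ∂(κ s)) * cov[h, k; κ s] -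
      (∫ ω, h ω ∂(κ s)) * cov[fun ω => f ω * g ω, k; κ s] :=
    hu3 hfgm hhm hkm (mul_nonneg hMf0 hMg0) hfg hMh hMk
  exact (((hA.sub ((hcovc hfm hkm hMf hMk).mul (hcovc hgm hhm hMg hMh))).sub ((hint hfm hMf).mul (hu3 hgm hhm hkm hMg0 hMg hMh hMk))).sub
    ((hcovc hgm hkm hMg hMk).mul (hcovc hfm hhm hMf hMh))).sub ((hint hgm hMg).mul (hu3 hfm hhm hkm hMf0 hMf hMh hMk))

end Continuity

/-! ### Feynman–Hellmann for the third cumulant -/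

section Deriv

variable {κ : ℝ → Measure Ω} {ι : Type*} {T : Finset ι} {Vd : ι → Ω → ℝ} {b : ℝ}

/-- **FEYNMAN–HELLMANN FOR `u₃`.**  Along a family `κ(s)` on which every bounded measurable mean differentiates at `b` with derivative
`−Σ_{A∈T} cov(·, V_A)` and every covariance of bounded measurable observables with derivative `−Σ_{A∈T} u₃(·; ·; V_A)` (all at `κ(b)`):
`d/ds u₃(F; G; K)|_{s=b} = −Σ_{A∈T} u₄(F; G; K; V_A)` — the derivative form of `u₄` is the product rule. -/
theorem hasDerivAt_threePoint_of_oracle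
    (hmean : ∀ {F : Ω → ℝ} {CF : ℝ}, Measurable F → (∀ U, |F U| ≤ CF) →
      HasDerivAt (fun s => ∫ U, F U ∂(κ s)) (-(∑ A ∈ T, cov[F, Vd A; κ b])) b)
    (hcovd : ∀ {F G : Ω → ℝ} {CF CG : ℝ}, Measurable F → (∀ U, |F U| ≤ CF) → Measurable G → (∀ U, |G U| ≤ CG) →
      HasDerivAt (fun s => cov[F, G; κ s]) (-(∑ A ∈ T, U₃[F ; G ; Vd A ; κ b])) b)
    {F G K : Ω → ℝ} {CF CG CK : ℝ} (hFm : Measurable F) (hFb : ∀ U, |F U| ≤ CF) (hGm : Measurable G) (hGb : ∀ U, |G U| ≤ CG)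
    (hKm : Measurable K) (hKb : ∀ U, |K U| ≤ CK) (hCF0 : 0 ≤ CF) :
    HasDerivAt (fun s => U₃[F ; G ; K ; κ s]) (-(∑ A ∈ T, U₄[F ; G ; K ; Vd A ; κ b])) b := by
  have hFG : ∀ U, |F U * G U| ≤ CF * CG := fun U => by rw [abs_mul]; exact mul_le_mul (hFb U) (hGb U) (abs_nonneg _) hCF0
  have d1 := hcovd (show Measurable (fun U => F U * G U) from hFm.mul hGm) hFG hKm hKb
  have d2 := hmean hFm hFb
  have d3 := hcovd hGm hGb hKm hKb
  have d4 := hmean hGm hGb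
  have d5 := hcovd hFm hFb hKm hKb
  have d := (d1.fun_sub (d2.fun_mul d3)).fun_sub (d4.fun_mul d5)
  refine d.congr_deriv ?_
  simp only [Finset.sum_sub_distrib, ← Finset.mul_sum, ← Finset.sum_mul]
  ring

end Deriv

end Summit.Ventures.YMGap.RobustBall

end
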